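import Summits.BirchSwinnertonDyer.BirchSwinnertonDyer.Theorems.KolyvaginRoadThreePTDescentAdjointCup
import Literature.NumberTheory.GaloisRepresentations.CorestrictionTransferComparison
import Literature.NumberTheory.GaloisRepresentations.CorNaturality
import Literature.NumberTheory.GaloisCohomology.LocalInvariantMap
import HarnessLib

/-!
# The (adjoint) binder of the prime-to-`p` descent, II: `⟨Res_{w/v} a, b'⟩_w = ⟨a, Cor^D_{w/v} b'⟩_v`
# for THE local Tate pairings

Route `KolyvaginRoadThree`, crux `ZhangSharpFrameAtThreeHL` (stmt-BirchSwinnertonDyer-19574), PT road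
(C) (`PT-ROAD-DESIGN-g19.md` ADDENDUM 2, brick N3): the LAST open binder `hadj` of the descent
certificate `middleExact_canonical_of_descentData` (p555478) for `ρ' = ρ|_{Γ_{K'}}` with the data
`localRes` / `localCorDual` (`KolyvaginRoadThreePTDescentLocalData(Dual)`), PROVED
(`localTatePairingZMod_localRes_eq_localCorDual`).  With `F = K_v`, `E = K'_w`,
`S' = Gal(F̄/ι⁻¹E) ≤ Γ_F` and `b' = κ_w (twist^D z)`:

* right-hand side: `Cor^D_{w/v} b' = cor_{S'} (liftTransport z)` — the transfer corestriction IS the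
  Shapiro corestriction in degree one (`galoisCohomology.cor_eq_cor_liftTransport`,
  `Literature/…/CorestrictionTransferComparison.lean`); the projection formula
  `a ∪_v cor_{S'} y = cor_{S'} (res_{S'} a ∪ y)` (`cor_cupProduct_resH`); naturality of `cor_{S'}` in
  `μₚ(K̄)|_v ≅ μₚ(F̄)` (`cor_cohomologyMap`); `ι₃( res a ∪ liftTransport z ) = pullLift( (ι₄ι₃)(Res a ∪_B z) )`
  (`shapiroCup_eq_pullLift`); `cor_{S'} ∘ pullLift = Cor_{E/F}` (`Prop121vii.corMu`); and
  **`inv_F ∘ Cor_{E/F} = inv_E`** (`Prop121vii.invLevel_corMu`, Serre *Local Fields* XI §2 Prop. 1 (ii) —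
  needed at this generality because `p` may divide `[K'_w : K_v]` even when `p ∤ [K' : K]`);
* left-hand side: `ι₂( Res_{w/v} a ∪_A b' ) = (ι₄ι₃)( Res a ∪_B z )` (`lhs_cup_eq`, part I).

Hence both sides equal `inv_E (ι₄ι₃)( Res a ∪_B z )`.  THEOREMS (and one coefficient morphism with
body); no named fact; no case of BSD; no new case of Poitou–Tate (this is the compatibility of local
Tate duality with a finite extension of the local field, Cassels–Fröhlich IV §6 / NSW (7.1.4)).

References: [SerreLocalFields1979] XI §2 Prop. 1 (ii), XIII §3 Prop. 7; [NeukirchSchmidtWingberg2008]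
I §5 Prop. 1.5.3 (iv), (7.1.4); [SerreGaloisCohomology1997] I §2.4–2.5; [MilneADT2006] I Cor. 2.3.
-/

noncomputable section

open CategoryTheory Function NumberField IsDedekindDomain
open scoped NumberField ContRepresentation Classical

set_option linter.dupNamespace false
set_option autoImplicit false

namespace Summit.BirchSwinnertonDyer.BirchSwinnertonDyer.Theorems.KolyvaginRoadThreePT

open Field
open Literature.NumberTheory.GaloisRepresentations Literature.NumberTheory.GaloisCohomology
open Literature.NumberTheory.GaloisRepresentations.DiscreteGaloisModule (mu MuCarrier TateDual tateDual
  unramifiedSubgroup tateDualPairingLocal localTatePairing localTatePairingZMod)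
open Literature.NumberTheory.GaloisRepresentations.SemiLocal (Place algebraPlace)
open _root_.TopRep _root_.ContRepresentation _root_.ContinuousCohomology

section AdjointRight

variable {K K' : Type} [Field K] [NumberField K] [Field K'] [NumberField K'] [Algebra K K']
variable {M : Type} [AddCommGroup M] [TopologicalSpace M] [DiscreteTopology M] [Finite M]
variable {p : ℕ} [NeZero p] (ρ : DiscreteGaloisModule K M)
variable (v : HeightOneSpectrum (𝓞 K)) (w : Place K K' v)

attribute [local instance] absoluteGaloisGroup_compactSpace

local notation "F" => HeightOneSpectrum.adicCompletion K v
local notation "E" => HeightOneSpectrum.adicCompletion K' (w : HeightOneSpectrum (𝓞 K'))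

/-! ## §4 The right-hand side through the Shapiro corestriction -/

open Literature.NumberTheory.GaloisRepresentations.LocalWeilDatum (galFixing embField isClosed_galFixing
  finiteDimensional_embField)
open Literature.AnabelianGeometry.AbsoluteAnabelian (Prop121vii.liftGalC Prop121vii.absGaloisRestrict_liftGalC
  Prop121vii.pullLift Prop121vii.pullLift_apply Prop121vii.liftCoeff Prop121vii.liftCoeff_hom_apply
  Prop121vii.corMu Prop121vii.invLevel_corMu Prop121vii.muRes Prop121vii.muResInv Prop121vii.muResInv_muRes
  Prop121vii.invLevel)

variable [CharZero (v.adicCompletion K)]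
  [FiniteDimensional (v.adicCompletion K) ((w : HeightOneSpectrum (𝓞 K')).adicCompletion K')]
  [IsClosed ((galFixing (v.adicCompletion K) (embField (v.adicCompletion K)
      ((w : HeightOneSpectrum (𝓞 K')).adicCompletion K')) : Subgroup (absoluteGaloisGroup (v.adicCompletion K))) :
    Set (absoluteGaloisGroup (v.adicCompletion K)))]
  [Fintype (absoluteGaloisGroup (v.adicCompletion K) ⧸ galFixing (v.adicCompletion K)
    (embField (v.adicCompletion K) ((w : HeightOneSpectrum (𝓞 K')).adicCompletion K')))]

example : IsClosed ((galFixing F (embField F E) : Subgroup (absoluteGaloisGroup F)) : Set (absoluteGaloisGroup F)) :=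
  inferInstance

/-- **`Cor^D_{w/v} (κ_w (twist^D z)) = cor_{S'} (liftTransport z)`**: the dual corestriction datum on
the class attached to `z ∈ H¹(K'_w, M^D|_v|_w)` is the Shapiro corestriction along
`S' = Gal(K̄_v/ι⁻¹K'_w) ≤ Γ_{K_v}` of its transport (`galoisCohomology.cor_eq_cor_liftTransport`).
[cite: SerreGaloisCohomology1997, I §2.5] -/
theorem localCorDual_eq_cor_liftTransport
    (z : galoisCohomology ((GaloisRep.toLocal v (ρ.tateDual p)).restrictField E) 1) :
    localCorDual (p := p) ρ v w (dualTransferLocal (p := p) ρ v w (twist v w (ρ.tateDual p) z)) =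
      cor (galFixing F (embField F E)) (GaloisRep.toLocal v (ρ.tateDual p)) 1
        (galoisCohomology.liftTransport E (GaloisRep.toLocal v (ρ.tateDual p)) 1 z) := by
  haveI := LocalField.charZero_adicCompletion v
  haveI := finiteDimensional_place' v w
  rw [localCorDual_apply, AddEquiv.symm_apply_apply, localCor_apply, AddEquiv.symm_apply_apply]
  exact galoisCohomology.cor_eq_cor_liftTransport E (GaloisRep.toLocal v (ρ.tateDual p)) z

omit [NeZero p] [CharZero (v.adicCompletion K)]
  [FiniteDimensional (v.adicCompletion K) ((w : HeightOneSpectrum (𝓞 K')).adicCompletion K')] in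
/-- **Projection formula at `v`**: `a ∪_v cor_{S'} y = cor_{S'} (res_{S'} a ∪_{S'} y)` for the local Tate
pairing (`cor_cupProduct_resH`). [cite: NeukirchSchmidtWingberg2008, I §5 Prop. 1.5.3 (iv)] -/
theorem localTatePairing_cor_eq (a : galoisCohomology (GaloisRep.toLocal v ρ) 1)
    (y : continuousCohomology 1
      ((GaloisRep.toLocal v (ρ.tateDual p)).restrict (subgroupIncl (galFixing F (embField F E)))).toTopRep) :
    localTatePairing ρ p (Sum.inr v) a (cor (galFixing F (embField F E)) (GaloisRep.toLocal v (ρ.tateDual p)) 1 y) =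
      cor (galFixing F (embField F E)) (GaloisRep.toLocal v (mu K p)) 2
        ((resPairing (galFixing F (embField F E)) (GaloisRep.toLocal v ρ) (GaloisRep.toLocal v (ρ.tateDual p))
          (GaloisRep.toLocal v (mu K p)) (tateDualPairingLocal ρ p (Sum.inr v))).cupProduct
          (resH (galFixing F (embField F E)) (GaloisRep.toLocal v ρ) 1 a) y) :=
  (cor_cupProduct_resH (galFixing F (embField F E)) (GaloisRep.toLocal v ρ) (GaloisRep.toLocal v (ρ.tateDual p))
    (GaloisRep.toLocal v (mu K p)) (tateDualPairingLocal ρ p (Sum.inr v)) a y).symm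

omit [CharZero (v.adicCompletion K)]
  [FiniteDimensional (v.adicCompletion K) ((w : HeightOneSpectrum (𝓞 K')).adicCompletion K')] in
/-- **Naturality of `cor_{S'}` in `μₚ(K̄)|_v ≅ μₚ(K̄_v)`** (`cor_cohomologyMap`). [cite: SerreGaloisCohomology1997, I §2.5] -/
theorem cohomologyMap_muLocalIso_cor
    (c : continuousCohomology 2 ((GaloisRep.toLocal v (mu K p)).restrict (subgroupIncl (galFixing F (embField F E)))).toTopRep) :
    cohomologyMap (muLocalIso v p).hom 2 (cor (galFixing F (embField F E)) (GaloisRep.toLocal v (mu K p)) 2 c) =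
      cor (galFixing F (embField F E)) (mu F p) 2
        (cohomologyMap (resModHom (galFixing F (embField F E)) (muLocalIso v p).hom) 2 c) :=
  (cor_cohomologyMap (galFixing F (embField F E)) (GaloisRep.toLocal v (mu K p)) (mu F p) (muLocalIso v p).hom 1 c).symm

omit [NeZero p] in
/-- `cor_{S'} ∘ pullLift = corMu` (unfolding `Prop121vii.corMu` for the ambient `Fintype` instance).
[cite: SerreGaloisCohomology1997, I §2.5] -/
theorem cor_pullLift_eq_corMu (y : galoisCohomology (mu E p) 2) :
    cor (galFixing F (embField F E)) (mu F p) 2 (Prop121vii.pullLift F E p 2 y) = Prop121vii.corMu F E p y := by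
  rename_i _ _ instF
  haveI := finiteDimensional_embField F E
  have h : instF = @Fintype.ofFinite _ (finite_quot_galFixing F (embField F E)) := Subsingleton.elim _ _
  subst h
  rfl

/-- The coefficient morphism `μₚ(K̄)|_v|_w|_{lift} → μₚ(K̄_v)|_{S'}`, `ζ ↦ ι₃ ζ`, over the lift
`S' → Γ_{K'_w}`. [cite: SerreGaloisCohomology1997, I §2.4] -/
def muLiftHom :
    TopRep.res (Prop121vii.liftGalC F E : galFixing F (embField F E) →* absoluteGaloisGroup E)
        (DiscreteGaloisModule.toTopRep ((GaloisRep.toLocal v (mu K p)).restrictField E)) ⟶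
      ((mu F p).restrict (subgroupIncl (galFixing F (embField F E)))).toTopRep :=
  TopRep.ofHom ⟨⟨(muTransfer K F p).toIntLinearMap, continuous_of_discreteTopology⟩, fun g => by
    refine ContinuousLinearMap.ext fun ζ => ?_
    change muTransfer K F p (mu K p (absGaloisRestrict K F (absGaloisRestrict F E (Prop121vii.liftGalC F E g))) ζ) =
      mu F p (g : absoluteGaloisGroup F) (muTransfer K F p ζ)
    rw [muTransfer_mu, Prop121vii.absGaloisRestrict_liftGalC]⟩

omit [Fintype (absoluteGaloisGroup (v.adicCompletion K) ⧸ galFixing (v.adicCompletion K)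
    (embField (v.adicCompletion K) ((w : HeightOneSpectrum (𝓞 K')).adicCompletion K')))] in
/-- **The Shapiro-side cup product is the `pullLift` of the `B`-cup product**:
`ι₃( res_{S'} a ∪_{S'} liftTransport z ) = pullLift( (ι₄ι₃)( Res a ∪_B z ) )` in `H²(S', μₚ(K̄_v))` —
both are `H²(lift, ι₃)(Res a ∪_B z)` (`cupProduct_map_of_pair`, `liftTransport_res`,
`map_comp_apply_of`, `ι₄⁻¹ ∘ ι₄ = id`). [cite: NeukirchSchmidtWingberg2008, I §5 Prop. 1.5.3] -/
theorem shapiroCup_eq_pullLift (a : galoisCohomology (GaloisRep.toLocal v ρ) 1)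
    (z : galoisCohomology ((GaloisRep.toLocal v (ρ.tateDual p)).restrictField E) 1) :
    cohomologyMap (resModHom (galFixing F (embField F E)) (muLocalIso v p).hom) 2
      ((resPairing (galFixing F (embField F E)) (GaloisRep.toLocal v ρ) (GaloisRep.toLocal v (ρ.tateDual p))
          (GaloisRep.toLocal v (mu K p)) (tateDualPairingLocal ρ p (Sum.inr v))).cupProduct
        (resH (galFixing F (embField F E)) (GaloisRep.toLocal v ρ) 1 a)
        (galoisCohomology.liftTransport E (GaloisRep.toLocal v (ρ.tateDual p)) 1 z)) =
    Prop121vii.pullLift F E p 2 (cohomologyMap (muEmbHom (p := p) v w) 2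
      ((pairingB (p := p) ρ v w).cupProduct (galoisCohomology.res (GaloisRep.toLocal v ρ) E 1 a) z)) := by
  haveI := LocalField.charZero_adicCompletion v
  haveI := finiteDimensional_place' v w
  rw [← galoisCohomology.liftTransport_res E (GaloisRep.toLocal v ρ) 1 a, galoisCohomology.liftTransport_apply,
    galoisCohomology.liftTransport_apply]
  have hcup := cupProduct_map_of_pair (pairingB (p := p) ρ v w)
    (resPairing (galFixing F (embField F E)) (GaloisRep.toLocal v ρ) (GaloisRep.toLocal v (ρ.tateDual p))
      (GaloisRep.toLocal v (mu K p)) (tateDualPairingLocal ρ p (Sum.inr v)))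
    (Prop121vii.liftGalC F E) (liftTransportHom E (GaloisRep.toLocal v ρ))
    (liftTransportHom E (GaloisRep.toLocal v (ρ.tateDual p))) (liftTransportHom E (GaloisRep.toLocal v (mu K p)))
    (fun _ _ => rfl) (galoisCohomology.res (GaloisRep.toLocal v ρ) E 1 a) z
  rw [← hcup]
  -- both sides are `H²(lift, ι₃)(Res a ∪_B z)`
  have hL : cohomologyMap (resModHom (galFixing F (embField F E)) (muLocalIso v p).hom) 2
      (ContinuousCohomology.map (Prop121vii.liftGalC F E) (liftTransportHom E (GaloisRep.toLocal v (mu K p))) 2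
        ((pairingB (p := p) ρ v w).cupProduct (galoisCohomology.res (GaloisRep.toLocal v ρ) E 1 a) z)) =
      ContinuousCohomology.map (Prop121vii.liftGalC F E) (muLiftHom (p := p) v w) 2
        ((pairingB (p := p) ρ v w).cupProduct (galoisCohomology.res (GaloisRep.toLocal v ρ) E 1 a) z) :=
    (map_comp_apply_of (Prop121vii.liftGalC F E) (ContinuousMonoidHom.id _) (Prop121vii.liftGalC F E)
      (fun _ => rfl) (liftTransportHom E (GaloisRep.toLocal v (mu K p)))
      (resIdHom (resModHom (galFixing F (embField F E)) (muLocalIso v p).hom)) (muLiftHom (p := p) v w)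
      (fun _ => rfl) 2 _).symm
  have hR : Prop121vii.pullLift F E p 2 (cohomologyMap (muEmbHom (p := p) v w) 2
      ((pairingB (p := p) ρ v w).cupProduct (galoisCohomology.res (GaloisRep.toLocal v ρ) E 1 a) z)) =
      ContinuousCohomology.map (Prop121vii.liftGalC F E) (muLiftHom (p := p) v w) 2
        ((pairingB (p := p) ρ v w).cupProduct (galoisCohomology.res (GaloisRep.toLocal v ρ) E 1 a) z) := by
    rw [Prop121vii.pullLift_apply]
    exact (map_comp_apply_of (ContinuousMonoidHom.id _) (Prop121vii.liftGalC F E) (Prop121vii.liftGalC F E)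
      (fun _ => rfl) (resIdHom (muEmbHom (p := p) v w)) (Prop121vii.liftCoeff F E p) (muLiftHom (p := p) v w)
      (fun ζ => (Prop121vii.muResInv_muRes F E p (muTransfer K F p ζ)).symm) 2 _).symm
  rw [hL, hR]


/-! ## §5 The (adjoint) binder -/

omit [CharZero (v.adicCompletion K)]
  [FiniteDimensional (v.adicCompletion K) ((w : HeightOneSpectrum (𝓞 K')).adicCompletion K')]
  [IsClosed ((galFixing (v.adicCompletion K) (embField (v.adicCompletion K)
      ((w : HeightOneSpectrum (𝓞 K')).adicCompletion K')) : Subgroup (absoluteGaloisGroup (v.adicCompletion K))) :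
    Set (absoluteGaloisGroup (v.adicCompletion K)))]
  [Fintype (absoluteGaloisGroup (v.adicCompletion K) ⧸ galFixing (v.adicCompletion K)
    (embField (v.adicCompletion K) ((w : HeightOneSpectrum (𝓞 K')).adicCompletion K')))] in
/-- **(adjoint) `⟨Res_{w/v} a, b'⟩_w = ⟨a, Cor^D_{w/v} b'⟩_v` for THE local Tate pairings** — the binder
`hadj` of `middleExact_canonical_of_descentData` for `ρ' = ρ|_{Γ_{K'}}` with the data `localRes`,
`localCorDual`.  Writing `b' = κ_w (twist^D z)`: the left side is `inv_w ι₂( Res a ∪_A κ_w twist^D z )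
= inv_{K'_w} (ι₄ι₃)( Res a ∪_B z )` (`lhs_cup_eq`); the right side is
`inv_v ι₃( a ∪_v cor_{S'} liftTransport z ) = inv_v ι₃ cor_{S'}( res a ∪ liftTransport z )
= inv_{K_v} corMu( (ι₄ι₃)( Res a ∪_B z ) )` (transfer = Shapiro corestriction, projection formula,
naturality, `shapiroCup_eq_pullLift`), and `inv_{K_v} ∘ Cor = inv_{K'_w}` (`Prop121vii.invLevel_corMu`,
Serre *Local Fields* XI §2 Prop. 1 (ii)). [cite: SerreLocalFields1979, XI §2 Prop. 1 (ii)]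
[cite: NeukirchSchmidtWingberg2008, I §5 Prop. 1.5.3 (iv)] -/
theorem localTatePairingZMod_localRes_eq_localCorDual (a : galoisCohomology (GaloisRep.toLocal v ρ) 1)
    (b' : galoisCohomology ((tateDual (ρ.restrictField K') p).restrictField E) 1) :
    localTatePairingZMod (ρ.restrictField K') p (Sum.inr (w : HeightOneSpectrum (𝓞 K')))
        (LocalInvariants.canonical K' p (Sum.inr (w : HeightOneSpectrum (𝓞 K')))) (localRes v w ρ a) b' =
      localTatePairingZMod ρ p (Sum.inr v) (LocalInvariants.canonical K p (Sum.inr v)) a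
        (localCorDual (p := p) ρ v w b') := by
  haveI : CharZero F := LocalField.charZero_adicCompletion v
  haveI : CharZero E := LocalField.charZero_adicCompletion (w : HeightOneSpectrum (𝓞 K'))
  haveI := finiteDimensional_place' v w
  haveI : IsClosed ((galFixing F (embField F E) : Subgroup (absoluteGaloisGroup F)) : Set (absoluteGaloisGroup F)) :=
    isClosed_galFixing F (embField F E)
  haveI := finiteDimensional_embField F E
  haveI : Finite (absoluteGaloisGroup F ⧸ galFixing F (embField F E)) := finite_quot_galFixing F (embField F E)
  letI : Fintype (absoluteGaloisGroup F ⧸ galFixing F (embField F E)) := Fintype.ofFinite _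
  obtain ⟨z, rfl⟩ : ∃ z, b' = dualTransferLocal (p := p) ρ v w (twist v w (ρ.tateDual p) z) :=
    ⟨(twist v w (ρ.tateDual p)).symm ((dualTransferLocal (p := p) ρ v w).symm b'), by
      rw [AddEquiv.apply_symm_apply, AddEquiv.apply_symm_apply]⟩
  rw [DiscreteGaloisModule.localTatePairingZMod_apply, DiscreteGaloisModule.localTatePairingZMod_apply,
    LocalInvariants.canonical_inr, LocalInvariants.canonical_inr, localInvariantMap_apply,
    localInvariantMap_apply]
  -- left-hand side
  have hL := congrArg (Prop121vii.invLevel E p) (lhs_cup_eq (p := p) ρ v w a z)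
  -- right-hand side
  have hR : Prop121vii.invLevel F p (cohomologyMap (muLocalIso v p).hom 2
      (localTatePairing ρ p (Sum.inr v) a
        (localCorDual (p := p) ρ v w (dualTransferLocal (p := p) ρ v w (twist v w (ρ.tateDual p) z))))) =
      Prop121vii.invLevel E p (cohomologyMap (muEmbHom (p := p) v w) 2
        ((pairingB (p := p) ρ v w).cupProduct (galoisCohomology.res (GaloisRep.toLocal v ρ) E 1 a) z)) := by
    rw [localCorDual_eq_cor_liftTransport, localTatePairing_cor_eq, cohomologyMap_muLocalIso_cor,
      shapiroCup_eq_pullLift, cor_pullLift_eq_corMu, Prop121vii.invLevel_corMu]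
  exact hL.trans hR.symm

end AdjointRight

end Summit.BirchSwinnertonDyer.BirchSwinnertonDyer.Theorems.KolyvaginRoadThreePT

end
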